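import Literature.Analysis.OperatorTheory.YangMillsMatrixModelLuscherSimonGapHolds
import Literature.Analysis.OperatorTheory.YangMillsMatrixModelCutoffEnergy
import Literature.Analysis.OperatorTheory.YangMillsMatrixModelRadialCutoff
import Literature.Analysis.OperatorTheory.YangMillsMatrixModelLevels
import Literature.Analysis.OperatorTheory.YangMillsMatrixModelAL1Holds
import Literature.Analysis.UnboundedOperators.CoreFormGroundStateSign
import HarnessLib

/-!
# The invariant ground state of Lüscher's matrix-model Hamiltonian does not change sign

Topic `Literature/Analysis/OperatorTheory`; companion of `YangMillsMatrixModelLuscherSimonGapHolds.lean`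
(`physLevel 1 < physLevel 2`: the `SO(3)`-invariant ground state of `𝔥 = −½Δ + ¼Σ|x_i × x_j|²` on `ℝ⁹` is simple)
and of `YangMillsMatrixModelGroundStatePositivity.lean` (E. Hopf: a nonnegative `C²` eigenfunction of `𝔥` is `> 0`
everywhere or `≡ 0`).  Here the companion classical fact is proved for CONCRETE eigenfunctions: **a colour-invariant
`C²` solution `ψ` of `𝔥ψ = E₁ψ` at the invariant ground level `E₁ = physLevel 1` with `|ψ| ≤ C e^{−‖x‖}` is either
everywhere `> 0` or everywhere `< 0`** (Courant–Hilbert VI §6 «the first eigenfunction does not change sign»;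
Reed–Simon IV Thm XIII.48; Lieb–Loss Thm 11.8), and consequently the eigenfunctions of the tree's PROVED named fact
`LuscherHamiltonianEigenfunctions k` (AL1) can be chosen with a STRICTLY POSITIVE ground state `f_0 > 0`.

PROOF.  The cut-offs `χ_R ψ` (`χ_R = radialCutoff R`) are invariant `C²_c` core functions with
`𝔮(χ_Rψ) − E₁‖χ_Rψ‖² = ½∫‖∇χ_R‖²ψ² = O(e^{−R})` (the tree's cut-off energy identity `energyForm_testFn_mul_of_eigen`,
Agmon (1.16″), and the tail bound `abs_gradTail_le`) and `χ_Rψ → ψ` in `L²` (`abs_integral_weight_mul_mul_le`), i.e. a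
MINIMIZING SEQUENCE of the datum `(coreSpace, coreEmbedding, coreOp)` for the level `E₁` (`physLevel_one_le_rayleigh`);
the core-language Perron–Frobenius step `Literature.Analysis.UnboundedOperators.sign_of_core_minimizing_seq` (contraction
`coreSpace_habs` + positivity improving `coreSpace_positivityImproving`) gives `ψ ≥ 0` or `ψ ≤ 0` a.e., continuity makes
it everywhere, and Hopf's dichotomy `pos_or_eq_zero_of_nonneg_of_hApply_eq` makes it strict.

* `memLp_two_of_abs_le_exp` — `|ψ| ≤ Ce^{−‖x‖}`, `ψ` continuous ⇒ `ψ ∈ L²(ℝ⁹)`;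
* `hApply_smul` / `hApply_neg` — `𝔥(cψ) = c𝔥ψ`, `𝔥(−ψ) = −𝔥ψ` pointwise on `C²` functions; `exists_coreSpace_of_testFn` —
  an invariant `C²_c` function as an element of the core space with its norms;
* `exists_core_cutoff_estimates` / `exists_core_minimizing_seq` — the cut-offs `χ_Rψ` as a core MINIMIZING SEQUENCE;
  `physLevel_one_mul_le_coreForm` — the level-one form bound on the core; `nonneg_of_toLp_nonneg` / `nonpos_of_toLp_nonpos`;
* ★ `groundState_pos_or_neg` — the sign dichotomy above;
* `groundState_sign_of_clauses` — for a family with the five AL1 clauses, `f_0 > 0` everywhere or `f_0 < 0` everywhere;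
* `exists_pos_groundState_of_clauses` — sign normalisation of a GIVEN family (`f'_0 = ±f_0 > 0`, `f'_j = f_j` for `j ≠ 0`);
* ★ `exists_eigenfunctions_pos_groundState` — AL1 WITH a positive ground state: for every `k` there are `f_0, …, f_k` with
  the five clauses of `LuscherHamiltonianEigenfunctions k` AND `∀ x, 0 < f_0 x`.

Theorems only; no definitions, no named facts, no instances.

## References
* [ReedSimonIV1978] M. Reed, B. Simon, *Methods of Modern Mathematical Physics IV*, §XIII.12 Thm XIII.47–48
  (the ground state of a Schrödinger operator is non-degenerate and strictly positive), Thm XIII.2, XIII.64.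
* [LiebLoss2001] E. H. Lieb, M. Loss, *Analysis*, 2nd ed., Thm 11.8 (uniqueness and positivity of minimizers,
  PDF pp. 205–206), Thm 9.10.
* [LopezGomez2012] J. López-Gómez, *Linear Second Order Elliptic Operators*, Ch. 1 Thm 1.2 (E. Hopf's minimum principle).
* [Agmon1982] S. Agmon, *Lectures on Exponential Decay of Solutions of Second-Order Elliptic Equations*, (1.16″),
  Cor. 4.5, Thm. 5.1.
* [Kato1966] T. Kato, *Perturbation Theory for Linear Operators*, VI §1.3 Example 1.8, §1.5 Thm 1.27.
-/

noncomputable section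

open MeasureTheory Filter Topology
open scoped InnerProductSpace BigOperators

namespace Literature.Analysis.OperatorTheory.YMMatrixModel

/-! ### 1. Two small facts: `L²`-membership from exponential decay; `𝔥(−ψ) = −𝔥ψ` -/

/-- A continuous function with `|ψ| ≤ C e^{−‖x‖}` is in `L²(ℝ⁹)` (`ψ² ≤ C² e^{−‖x‖}`, integrable). [cite: Agmon1982, Cor. 4.5] -/
theorem memLp_two_of_abs_le_exp {ψ : ZM → ℝ} (hc : Continuous ψ) {C : ℝ}
    (hC : ∀ x, |ψ x| ≤ C * Real.exp (-‖x‖)) : MemLp ψ 2 (volume : Measure ZM) := by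
  rw [memLp_two_iff_integrable_sq hc.aestronglyMeasurable]
  refine Integrable.mono' (integrable_exp_neg_norm.const_mul (C ^ 2)) (hc.pow 2).aestronglyMeasurable
    (Eventually.of_forall fun x => ?_)
  have h1 : |ψ x| ^ 2 ≤ (C * Real.exp (-‖x‖)) ^ 2 := pow_le_pow_left₀ (abs_nonneg _) (hC x) 2
  have h2 : Real.exp (-‖x‖) ≤ 1 := Real.exp_le_one_iff.mpr (neg_nonpos.mpr (norm_nonneg x))
  have h3 : Real.exp (-‖x‖) ^ 2 ≤ Real.exp (-‖x‖) := by
    rw [sq]; exact mul_le_of_le_one_left (Real.exp_pos _).le h2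
  rw [Real.norm_eq_abs, abs_of_nonneg (sq_nonneg _), ← sq_abs]
  calc |ψ x| ^ 2 ≤ (C * Real.exp (-‖x‖)) ^ 2 := h1
    _ = C ^ 2 * Real.exp (-‖x‖) ^ 2 := by ring
    _ ≤ C ^ 2 * Real.exp (-‖x‖) := mul_le_mul_of_nonneg_left h3 (sq_nonneg C)

/-- `𝔥` is homogeneous: `𝔥(cψ)(x) = c·𝔥ψ(x)` for `ψ ∈ C²` (linearity of `Δ`). [cite: ReedSimonIV1978, Thm. XIII.2] -/
theorem hApply_smul {ψ : ZM → ℝ} (hψ : ContDiff ℝ 2 ψ) (c : ℝ) (x : ZM) : hApply (c • ψ) x = c * hApply ψ x := by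
  have hd : Differentiable ℝ ψ := differentiable_of_contDiff_two hψ
  have e1 : ∀ q, pderiv q (c • ψ) = c • pderiv q ψ := fun q => by
    funext y
    rw [pderiv_smul hd, Pi.smul_apply, smul_eq_mul]
  have e2 : ∀ p q, pderiv p (pderiv q (c • ψ)) x = c * pderiv p (pderiv q ψ) x := fun p q => by
    rw [e1 q, pderiv_smul (differentiable_pderiv_of_contDiff_two hψ q)]
  rw [hApply_def, hApply_def, laplacian_def, laplacian_def]
  simp only [e2, ← Finset.mul_sum, Pi.smul_apply, smul_eq_mul]
  ring

/-- `𝔥` is odd: `𝔥(−ψ)(x) = −𝔥ψ(x)` for `ψ ∈ C²`. [cite: ReedSimonIV1978, Thm. XIII.2] -/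
theorem hApply_neg {ψ : ZM → ℝ} (hψ : ContDiff ℝ 2 ψ) (x : ZM) : hApply (-ψ) x = -hApply ψ x := by
  rw [show -ψ = (-1 : ℝ) • ψ from (neg_one_smul ℝ ψ).symm, hApply_smul hψ, neg_one_mul]

/-- **A core FUNCTION as a core ELEMENT.**  An invariant `C²_c` function `g` gives a core element `u` (its features)
with `ι u = [g]`, `‖u‖² = ‖g‖² + 𝔮(g)` and `‖ι u‖² = ‖g‖²`. [cite: Kato1966, VI §1.3 Example 1.8] -/
theorem exists_coreSpace_of_testFn {g : ZM → ℝ} (hg : IsTestFn g ∧ IsGaugeInv g) :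
    ∃ u : coreSpace, coreEmbedding u = (memLp_two_of_isTestFn hg.1).toLp g ∧
      ‖u‖ ^ 2 = l2sq g + energyForm g ∧ ‖coreEmbedding u‖ ^ 2 = l2sq g := by
  set u : coreSpace := ⟨coreFeature ⟨g, hg⟩, LinearMap.mem_range_self coreFeature _⟩ with hu
  have hι : coreEmbedding u = (memLp_two_of_isTestFn hg.1).toLp g := by
    rw [coreEmbedding_apply']
    exact coreFeature_apply_none ⟨g, hg⟩
  have hn : ‖u‖ ^ 2 = l2sq g + energyForm g := norm_coreFeature_sq ⟨g, hg⟩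
  refine ⟨u, hι, hn, ?_⟩
  rw [hι, ← real_inner_self_eq_norm_sq, inner_toLp_toLp, l2sq]
  exact integral_congr_ae (Eventually.of_forall fun x => by simp only [sq])

/-! ### 2. The cut-off minimizing sequence `χ_R ψ` in the invariant core -/

/-- The weight `(χ_R − 1)²` of the `L²`-tail is bounded by `1` (`0 ≤ χ_R ≤ 1`). [cite: Agmon1982, Cor. 4.5] -/
theorem abs_sq_radialCutoff_sub_one_le (R : ℝ) (x : ZM) : |(radialCutoff R x - 1) ^ 2| ≤ 1 := by
  have hm := radialCutoff_mem_Icc R x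
  rw [abs_of_nonneg (sq_nonneg _), sq_le_one_iff_abs_le_one, abs_le]
  constructor <;> linarith [hm.1, hm.2]

/-- **`L²`-tail of one cut-off.**  For `|ψ| ≤ Ce^{−‖x‖}` continuous... as an `L²` class: with `u` a core element
whose image is `[χ_R ψ]`, `‖ι u − [ψ]‖² ≤ C²e^{−R}∫e^{−‖x‖}` (`χ_R = 1` on the ball of radius `R`). [cite: Agmon1982, Cor. 4.5] -/
theorem norm_cutoff_sub_sq_le {ψ : ZM → ℝ} {C : ℝ} (hC : ∀ x, |ψ x| ≤ C * Real.exp (-‖x‖))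
    (hψL2 : MemLp ψ 2 (volume : Measure ZM)) {R : ℝ} (hg : MemLp (radialCutoff R * ψ) 2 (volume : Measure ZM))
    (hone : ∀ x : ZM, ‖x‖ < R → radialCutoff R x = 1) :
    ‖hg.toLp (radialCutoff R * ψ) - hψL2.toLp ψ‖ ^ 2 ≤ 1 * C * C * Real.exp (-R) * ∫ x : ZM, Real.exp (-‖x‖) := by
  have hsq : ‖hg.toLp (radialCutoff R * ψ) - hψL2.toLp ψ‖ ^ 2 = ∫ x, (radialCutoff R x - 1) ^ 2 * (ψ x * ψ x) := by
    rw [← MemLp.toLp_sub, ← real_inner_self_eq_norm_sq, inner_toLp_toLp]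
    refine integral_congr_ae (Eventually.of_forall fun x => ?_)
    simp only [Pi.sub_apply, Pi.mul_apply]
    ring
  rw [hsq]
  refine (le_abs_self _).trans (abs_integral_weight_mul_mul_le hC hC
    (fun x => abs_sq_radialCutoff_sub_one_le R x) fun x hx => ?_)
  show (radialCutoff R x - 1) ^ 2 = 0
  rw [hone x hx]
  ring

/-- **Energy excess of one cut-off.**  For a `C²` solution of `𝔥ψ = Eψ` with `|ψ| ≤ Ce^{−‖x‖}` and a `C²_c` cut-off
`χ_R` (`= 1` on the ball of radius `R`, `‖∇χ_R‖² ≤ M₁`): `|𝔮(χ_Rψ) − E‖χ_Rψ‖²| = ½∫‖∇χ_R‖²ψ² ≤ ½M₁C²e^{−R}∫e^{−‖x‖}`.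
[cite: Agmon1982, (1.16″), Cor. 4.5] -/
theorem abs_energyForm_cutoff_sub_le {ψ : ZM → ℝ} (hψ : ContDiff ℝ 2 ψ) {E : ℝ} (heig : ∀ x, hApply ψ x = E * ψ x)
    {C : ℝ} (hC : ∀ x, |ψ x| ≤ C * Real.exp (-‖x‖)) {R M₁ : ℝ} (hχ : IsTestFn (radialCutoff R))
    (hone : ∀ x : ZM, ‖x‖ < R → radialCutoff R x = 1) (hgrad : ∀ x : ZM, ‖gradient (radialCutoff R) x‖ ^ 2 ≤ M₁) :
    |energyForm (radialCutoff R * ψ) - E * l2sq (radialCutoff R * ψ)| ≤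
      (1 / 2 : ℝ) * (M₁ * C * C * Real.exp (-R) * ∫ x : ZM, Real.exp (-‖x‖)) := by
  have heig' : ∀ x : ZM, -(1 / 2 : ℝ) * (∑ p, pderiv p (pderiv p ψ) x) + luscherPotential x * ψ x = E * ψ x :=
    fun x => (hApply_eq_iff x).mp (heig x)
  have h1 : energyForm (radialCutoff R * ψ) = E * (∫ x, radialCutoff R x ^ 2 * ψ x ^ 2) +
      (1 / 2 : ℝ) * ∫ x, ‖gradient (radialCutoff R) x‖ ^ 2 * ψ x ^ 2 :=
    energyForm_testFn_mul_of_eigen hχ hψ heig'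
  have h2 : l2sq (radialCutoff R * ψ) = ∫ x, radialCutoff R x ^ 2 * ψ x ^ 2 := l2sq_testFn_mul _ _
  have h3 : (∫ x, ‖gradient (radialCutoff R) x‖ ^ 2 * (ψ x * ψ x)) =
      ∫ x, ‖gradient (radialCutoff R) x‖ ^ 2 * ψ x ^ 2 :=
    integral_congr_ae (Eventually.of_forall fun x => by simp only [sq])
  have hq : energyForm (radialCutoff R * ψ) - E * l2sq (radialCutoff R * ψ) =
      (1 / 2 : ℝ) * ∫ x, ‖gradient (radialCutoff R) x‖ ^ 2 * (ψ x * ψ x) := by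
    rw [h1, h2, h3]
    ring
  rw [hq, abs_mul, abs_of_pos (by norm_num : (0 : ℝ) < 1 / 2)]
  exact mul_le_mul_of_nonneg_left (abs_gradTail_le hC hC hgrad hone) (by norm_num)
set_option maxHeartbeats 400000 in -- buildfix (bf3-g31): 160k/180k FAIL, 200k PASS at accept time; line-neutral budget line
/-- **One cut-off.**  For a colour-invariant `C²` solution of `𝔥ψ = Eψ` with `|ψ| ≤ Ce^{−‖x‖}` and `R ≥ 1` there is a
core element `u` (the features of `χ_R ψ`) with `‖ι u − ψ‖²_{L²} ≤ C²e^{−R}∫e^{−‖x‖}` and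
`|‖u‖² − (E+1)‖ι u‖²| ≤ ½M₁C²e^{−R}∫e^{−‖x‖}` (`M₁` the uniform gradient bound of the radial cut-offs).
[cite: Agmon1982, (1.16″), Cor. 4.5] -/
theorem exists_core_cutoff_estimates {ψ : ZM → ℝ} (hψ : ContDiff ℝ 2 ψ) (hinv : IsGaugeInv ψ) {E : ℝ}
    (heig : ∀ x, hApply ψ x = E * ψ x) {C : ℝ} (hC : ∀ x, |ψ x| ≤ C * Real.exp (-‖x‖))
    (hψL2 : MemLp ψ 2 (volume : Measure ZM)) {M₁ : ℝ}
    (hM₁ : ∀ R : ℝ, 1 ≤ R → IsTestFn (radialCutoff R) ∧ IsGaugeInv (radialCutoff R) ∧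
      (∀ x : ZM, ‖x‖ < R → radialCutoff R x = 1) ∧ (∀ x : ZM, |1 - radialCutoff R x ^ 2| ≤ 1) ∧
      (∀ x : ZM, ‖gradient (radialCutoff R) x‖ ^ 2 ≤ M₁))
    {R : ℝ} (hR : 1 ≤ R) :
    ∃ u : coreSpace,
      ‖coreEmbedding u - hψL2.toLp ψ‖ ^ 2 ≤ 1 * C * C * Real.exp (-R) * ∫ x : ZM, Real.exp (-‖x‖) ∧
      |‖u‖ ^ 2 - (E + 1) * ‖coreEmbedding u‖ ^ 2| ≤
        (1 / 2 : ℝ) * (M₁ * C * C * Real.exp (-R) * ∫ x : ZM, Real.exp (-‖x‖)) := by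
  obtain ⟨hχ, hχinv, hone, -, hgrad⟩ := hM₁ R hR
  -- the cut-off `g = χ_R ψ`, an invariant core function
  have hg : IsTestFn (radialCutoff R * ψ) ∧ IsGaugeInv (radialCutoff R * ψ) := by
    refine ⟨⟨hχ.1.mul hψ, hχ.2.mul_right⟩, fun M hM x => ?_⟩
    simp only [Pi.mul_apply]
    rw [hχinv M hM x, hinv M hM x]
  obtain ⟨u, hι, hnormv, hnormι⟩ := exists_coreSpace_of_testFn hg
  refine ⟨u, ?_, ?_⟩
  · rw [hι]
    exact norm_cutoff_sub_sq_le hC hψL2 (memLp_two_of_isTestFn hg.1) hone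
  · -- arithmetic on abstract reals (no rewriting inside the mixed `‖u‖ / ‖ι u‖` expression)
    have key : ∀ a b l q : ℝ, a = l + q → b = l → a - (E + 1) * b = q - E * l := by
      intro a b l q ha hb
      rw [ha, hb]
      ring
    have hq : ‖u‖ ^ 2 - (E + 1) * ‖coreEmbedding u‖ ^ 2 =
        energyForm (radialCutoff R * ψ) - E * l2sq (radialCutoff R * ψ) := key _ _ _ _ hnormv hnormι
    exact (congrArg (fun t : ℝ => |t|) hq).trans_le (abs_energyForm_cutoff_sub_le hψ heig hC hχ hone hgrad)

/-- **The cut-off minimizing sequence.**  For `ψ` as above at level `E` there are core elements `v_n` (the features of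
`χ_{n+1}ψ`) with `ι v_n → ψ` in `L²` and `‖v_n‖² − (E+1)‖ι v_n‖² → 0`. [cite: Agmon1982, (1.16″), Cor. 4.5] -/
theorem exists_core_minimizing_seq {ψ : ZM → ℝ} (hψ : ContDiff ℝ 2 ψ) (hinv : IsGaugeInv ψ) {E : ℝ}
    (heig : ∀ x, hApply ψ x = E * ψ x) {C : ℝ} (hC : ∀ x, |ψ x| ≤ C * Real.exp (-‖x‖))
    (hψL2 : MemLp ψ 2 (volume : Measure ZM)) :
    ∃ v : ℕ → coreSpace, Tendsto (fun n => coreEmbedding (v n)) atTop (𝓝 (hψL2.toLp ψ)) ∧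
      Tendsto (fun n => ‖v n‖ ^ 2 - (E + 1) * ‖coreEmbedding (v n)‖ ^ 2) atTop (𝓝 0) := by
  obtain ⟨M₁, -, hpack⟩ := radialCutoff_package
  have hR1 : ∀ n : ℕ, (1 : ℝ) ≤ (n : ℝ) + 1 := fun n => by
    have : (0 : ℝ) ≤ n := Nat.cast_nonneg n
    linarith
  choose v hv1 hv2 using fun n : ℕ => exists_core_cutoff_estimates hψ hinv heig hC hψL2 hpack (hR1 n)
  have hexp_lim : Tendsto (fun n : ℕ => Real.exp (-((n : ℝ) + 1))) atTop (𝓝 0) := by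
    have h1 : Tendsto (fun n : ℕ => (n : ℝ) + 1) atTop atTop :=
      tendsto_atTop_add_const_right atTop 1 tendsto_natCast_atTop_atTop
    exact Real.tendsto_exp_neg_atTop_nhds_zero.comp h1
  refine ⟨v, ?_, ?_⟩
  · rw [tendsto_iff_norm_sub_tendsto_zero]
    have hsq_lim : Tendsto (fun n => ‖coreEmbedding (v n) - hψL2.toLp ψ‖ ^ 2) atTop (𝓝 0) := by
      have hb : Tendsto (fun n : ℕ => 1 * C * C * Real.exp (-((n : ℝ) + 1)) * ∫ x : ZM, Real.exp (-‖x‖))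
          atTop (𝓝 0) := by
        have := (hexp_lim.const_mul (1 * C * C)).mul_const (∫ x : ZM, Real.exp (-‖x‖))
        simpa using this
      exact squeeze_zero (fun n => sq_nonneg _) hv1 hb
    have h := hsq_lim.sqrt
    rw [Real.sqrt_zero] at h
    exact h.congr fun n => Real.sqrt_sq (norm_nonneg _)
  · have hb : Tendsto (fun n : ℕ => (1 / 2 : ℝ) * (M₁ * C * C * Real.exp (-((n : ℝ) + 1)) *
        ∫ x : ZM, Real.exp (-‖x‖))) atTop (𝓝 0) := by
      have := ((hexp_lim.const_mul (M₁ * C * C)).mul_const (∫ x : ZM, Real.exp (-‖x‖))).const_mul (1 / 2 : ℝ)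
      simpa using this
    exact squeeze_zero_norm (fun n => by rw [Real.norm_eq_abs]; exact hv2 n) hb
set_option maxHeartbeats 400000 in -- buildfix (bf3-g31): 160k/180k FAIL, 200k PASS at accept time; line-neutral budget line
/-- **The form lower bound at level one on the core space**: `physLevel 1 · ‖ι u‖² ≤ ‖u‖² − ‖ι u‖²` (`= 𝔮(Ψu)`) for every
core element (the variational principle `physLevel_one_le_rayleigh`). [cite: ReedSimonIV1978, Thm. XIII.1–2] -/
theorem physLevel_one_mul_le_coreForm (u : coreSpace) :
    physLevel 1 * ‖coreEmbedding u‖ ^ 2 ≤ ‖u‖ ^ 2 - ‖coreEmbedding u‖ ^ 2 := by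
  obtain ⟨h1, h2⟩ := coreSpace_form_data u
  by_cases h0 : ((coreInv u : coreSubmodule) : ZM → ℝ) = 0
  · have hz : ‖coreEmbedding u‖ ^ 2 = 0 := by
      rw [← h2, h0]
      simp [l2sq]
    rw [hz, mul_zero, sub_zero]
    positivity
  · have hmem := coreSubmodule_mem_spec (coreInv u)
    rw [← h1, ← h2]
    exact (le_div_iff₀ (l2sq_pos_of_ne_zero hmem.1 h0)).1 (physLevel_one_le_rayleigh hmem.1 hmem.2 h0)

/-- A continuous `L²` function whose class is `≥ 0` is `≥ 0` everywhere. [cite: LiebLoss2001, Thm. 11.8] -/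
theorem nonneg_of_toLp_nonneg {ψ : ZM → ℝ} (hc : Continuous ψ) (hψL2 : MemLp ψ 2 (volume : Measure ZM))
    (h0 : 0 ≤ hψL2.toLp ψ) (x : ZM) : 0 ≤ ψ x := by
  have hae0 : ∀ᵐ y ∂(volume : Measure ZM), 0 ≤ ψ y := by
    filter_upwards [(Lp.coeFn_nonneg _).2 h0, hψL2.coeFn_toLp] with y h1 h2
    rw [← h2]; exact h1
  have hmin : (fun y => min (ψ y) 0) =ᵐ[volume] fun _ => (0 : ℝ) := by
    filter_upwards [hae0] with y hy
    exact min_eq_right hy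
  have heq := ((hc.min continuous_const).ae_eq_iff_eq volume continuous_const).1 hmin
  exact min_eq_right_iff.1 (congrFun heq x)

/-- A continuous `L²` function whose class is `≤ 0` is `≤ 0` everywhere. [cite: LiebLoss2001, Thm. 11.8] -/
theorem nonpos_of_toLp_nonpos {ψ : ZM → ℝ} (hc : Continuous ψ) (hψL2 : MemLp ψ 2 (volume : Measure ZM))
    (h0 : hψL2.toLp ψ ≤ 0) (x : ZM) : ψ x ≤ 0 := by
  have hae0 : ∀ᵐ y ∂(volume : Measure ZM), ψ y ≤ 0 := by
    filter_upwards [(Lp.coeFn_le _ _).2 h0, hψL2.coeFn_toLp, Lp.coeFn_zero ℝ 2 (volume : Measure ZM)]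
      with y h1 h2 h3
    rw [← h2]
    have h4 := h1
    rw [h3] at h4
    exact h4
  have hmax : (fun y => max (ψ y) 0) =ᵐ[volume] fun _ => (0 : ℝ) := by
    filter_upwards [hae0] with y hy
    exact max_eq_right hy
  have heq := ((hc.max continuous_const).ae_eq_iff_eq volume continuous_const).1 hmax
  exact max_eq_right_iff.1 (congrFun heq x)

/-! ### 3. ★ The sign dichotomy for invariant ground states -/

/-- ★ **The invariant ground state of `𝔥` does not change sign.**  A colour-rotation invariant `C²` function `ψ` on
`ℝ⁹` with `𝔥ψ = physLevel 1 · ψ` pointwise, `|ψ(x)| ≤ C e^{−‖x‖}`, and `ψ ≢ 0` is either strictly positive everywhere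
or strictly negative everywhere.  (Minimizing sequence `χ_Rψ` in the invariant core + the variational
Perron–Frobenius step + Hopf's minimum principle; see the module docstring.)
[cite: ReedSimonIV1978, Thm. XIII.48] [cite: LiebLoss2001, Thm. 11.8, PDF pp. 205–206] [cite: LopezGomez2012, Thm. 1.2] -/
theorem groundState_pos_or_neg {ψ : ZM → ℝ} (hψ : ContDiff ℝ 2 ψ) (hinv : IsGaugeInv ψ)
    (heig : ∀ x, hApply ψ x = physLevel 1 * ψ x) (hdec : ∃ C : ℝ, ∀ x, |ψ x| ≤ C * Real.exp (-‖x‖))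
    (hne : ∃ x, ψ x ≠ 0) : (∀ x, 0 < ψ x) ∨ (∀ x, ψ x < 0) := by
  obtain ⟨C, hC⟩ := hdec
  have hcont : Continuous ψ := hψ.continuous
  have hψL2 : MemLp ψ 2 (volume : Measure ZM) := memLp_two_of_abs_le_exp hcont hC
  obtain ⟨v, hfw, hmin⟩ := exists_core_minimizing_seq hψ hinv heig hC hψL2
  have hm1 : (-1 : ℝ) < physLevel 1 := by
    have h0 : 0 ≤ physLevel 1 := physLevel_nonneg le_rfl
    linarith
  -- the core-language Perron–Frobenius step
  have hsign : 0 ≤ hψL2.toLp ψ ∨ hψL2.toLp ψ ≤ 0 :=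
    Literature.Analysis.UnboundedOperators.sign_of_core_minimizing_seq coreEmbedding coreOp
      coreSpace_form_identity coreSpace_habs coreSpace_positivityImproving hm1 physLevel_one_mul_le_coreForm v hfw hmin
  have hne' : ¬ ∀ x, ψ x = 0 := fun h => by obtain ⟨x, hx⟩ := hne; exact hx (h x)
  rcases hsign with h0 | h0
  · -- `ψ ≥ 0` everywhere, hence `> 0` (Hopf)
    exact Or.inl ((pos_or_eq_zero_of_nonneg_of_hApply_eq hψ (nonneg_of_toLp_nonneg hcont hψL2 h0) heig).resolve_right
      hne')
  · -- `ψ ≤ 0` everywhere, hence `< 0` (Hopf for `−ψ`)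
    have hψ0 := nonpos_of_toLp_nonpos hcont hψL2 h0
    have hnψ0 : ∀ x, 0 ≤ (-ψ) x := fun x => neg_nonneg.2 (hψ0 x)
    have hneig : ∀ x, hApply (-ψ) x = physLevel 1 * (-ψ) x := fun x => by
      rw [hApply_neg hψ, heig x, Pi.neg_apply, mul_neg]
    have hnne : ¬ ∀ x, (-ψ) x = 0 := fun h => hne' fun x => neg_eq_zero.1 (h x)
    have hpos := (pos_or_eq_zero_of_nonneg_of_hApply_eq hψ.neg hnψ0 hneig).resolve_right hnne
    exact Or.inr fun x => neg_pos.1 (hpos x)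

/-! ### 3. AL1 families: the ground state `f_0` has a strict sign and may be chosen positive -/

/-- For a family `f_0, …, f_k` with the five clauses of `LuscherHamiltonianEigenfunctions k` (smooth, colour-invariant,
`L²`-orthonormal, classical eigenfunctions at `physLevel (j+1)`, `ExpDecay₂`), the ground state `f_0` is everywhere
`> 0` or everywhere `< 0`. [cite: ReedSimonIV1978, Thm. XIII.48] [cite: LiebLoss2001, Thm. 11.8] -/
theorem groundState_sign_of_clauses {k : ℕ} {f : Fin (k + 1) → ZM → ℝ}
    (hsmooth : ∀ j, ∀ n : ℕ∞, ContDiff ℝ n (f j)) (hinv : ∀ j, IsGaugeInv (f j))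
    (horth : ∀ i j, ∫ x, f i x * f j x = if i = j then (1 : ℝ) else 0)
    (heig : ∀ j, ∀ x : ZM, hApply (f j) x = physLevel ((j : ℕ) + 1) * f j x)
    (hdec : ∀ j, ExpDecay₂ (f j)) : (∀ x, 0 < f 0 x) ∨ (∀ x, f 0 x < 0) := by
  have heig0 : ∀ x, hApply (f 0) x = physLevel 1 * f 0 x := fun x => by
    have h := heig 0 x
    simp only [Fin.val_zero, zero_add] at h
    exact h
  obtain ⟨C, -, hC⟩ := (hdec 0).exists_abs_le
  refine groundState_pos_or_neg (contDiff_two_of_forall (hsmooth 0)) (hinv 0) heig0 ⟨C, hC⟩ ?_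
  by_contra h
  have h' : ∀ x, f 0 x = 0 := fun x => by
    by_contra hx
    exact h ⟨x, hx⟩
  have h1 := horth 0 0
  rw [if_pos rfl] at h1
  have h2 : (∫ x, f 0 x * f 0 x) = 0 := by simp [h']
  rw [h2] at h1
  exact zero_ne_one h1

/-- **Sign normalisation of a given family.**  For `f_0, …, f_k` with the five AL1 clauses there is a family `f'` with the
same clauses, `f'_j = f_j` for `j ≠ 0`, `f'_0 = ± f_0`, and `f'_0 > 0` everywhere (flip the sign of `f_0` if it is negative).
[cite: ReedSimonIV1978, Thm. XIII.47–48] [cite: LiebLoss2001, Thm. 11.8] -/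
theorem exists_pos_groundState_of_clauses {k : ℕ} {f : Fin (k + 1) → ZM → ℝ}
    (hsmooth : ∀ j, ∀ n : ℕ∞, ContDiff ℝ n (f j)) (hinv : ∀ j, IsGaugeInv (f j))
    (horth : ∀ i j, ∫ x, f i x * f j x = if i = j then (1 : ℝ) else 0)
    (heig : ∀ j, ∀ x : ZM, hApply (f j) x = physLevel ((j : ℕ) + 1) * f j x)
    (hdec : ∀ j, ExpDecay₂ (f j)) :
    ∃ f' : Fin (k + 1) → ZM → ℝ,
      (∀ j, ∀ n : ℕ∞, ContDiff ℝ n (f' j)) ∧ (∀ j, IsGaugeInv (f' j)) ∧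
      (∀ i j, ∫ x, f' i x * f' j x = if i = j then (1 : ℝ) else 0) ∧
      (∀ j, ∀ x : ZM, hApply (f' j) x = physLevel ((j : ℕ) + 1) * f' j x) ∧
      (∀ j, ExpDecay₂ (f' j)) ∧ (∀ x, 0 < f' 0 x) ∧ (∀ j, j ≠ 0 → f' j = f j) ∧ (f' 0 = f 0 ∨ f' 0 = -f 0) := by
  rcases groundState_sign_of_clauses hsmooth hinv horth heig hdec with hpos | hneg
  · exact ⟨f, hsmooth, hinv, horth, heig, hdec, hpos, fun j _ => rfl, Or.inl rfl⟩
  -- flip the sign of `f_0`: `f'_j = s_j f_j`, `s_0 = −1`, `s_j = 1` otherwise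
  set s : Fin (k + 1) → ℝ := fun j => if j = 0 then -1 else 1 with hs_def
  have hs0 : s 0 = -1 := by simp [hs_def]
  have hsj : ∀ j, j ≠ 0 → s j = 1 := fun j hj => by simp [hs_def, hj]
  have hs2 : ∀ j, s j * s j = 1 := fun j => by
    by_cases hj : j = 0 <;> simp [hs_def, hj]
  have hsabs : ∀ j, |s j| = 1 := fun j => by
    by_cases hj : j = 0 <;> simp [hs_def, hj]
  set f' : Fin (k + 1) → ZM → ℝ := fun j x => s j * f j x with hf'_def
  have hf'smul : ∀ j, f' j = s j • f j := fun j => by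
    funext x; simp [hf'_def]
  refine ⟨f', fun j n => ?_, fun j M hM x => ?_, fun i j => ?_, fun j x => ?_, fun j => ?_, fun x => ?_,
    fun j hj => ?_, Or.inr ?_⟩
  · rw [hf'smul]; exact (hsmooth j n).const_smul (s j)
  · simp only [hf'_def, hinv j M hM x]
  · have e : (fun x => f' i x * f' j x) = fun x => (s i * s j) * (f i x * f j x) := by
      funext x; simp only [hf'_def]; ring
    rw [e, integral_const_mul, horth i j]
    by_cases hij : i = j
    · subst hij; rw [if_pos rfl, hs2, one_mul]
    · rw [if_neg hij, mul_zero]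
  · rw [hf'smul j, hApply_smul (contDiff_two_of_forall (hsmooth j)), heig j x, Pi.smul_apply, smul_eq_mul]
    ring
  · obtain ⟨C, hC⟩ := hdec j
    have hd2 : ContDiff ℝ 2 (f j) := contDiff_two_of_forall (hsmooth j)
    have hd : Differentiable ℝ (f j) := differentiable_of_contDiff_two hd2
    have e1 : ∀ p, pderiv p (f' j) = s j • pderiv p (f j) := fun p => by
      rw [hf'smul]; funext x; rw [pderiv_smul hd, Pi.smul_apply, smul_eq_mul]
    have e2 : ∀ p q x, pderiv p (pderiv q (f' j)) x = s j * pderiv p (pderiv q (f j)) x := fun p q x => by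
      rw [e1 q, pderiv_smul (differentiable_pderiv_of_contDiff_two hd2 q)]
    refine ⟨C, fun x => ⟨?_, fun p => ?_, fun p q => ?_⟩⟩
    · simp only [hf'_def, abs_mul, hsabs, one_mul]; exact (hC x).1
    · rw [e1 p, Pi.smul_apply, smul_eq_mul, abs_mul, hsabs, one_mul]; exact (hC x).2.1 p
    · rw [e2, abs_mul, hsabs, one_mul]; exact (hC x).2.2 p q
  · show 0 < s 0 * f 0 x
    rw [hs0, neg_one_mul]
    exact neg_pos.2 (hneg x)
  · funext x
    show s j * f j x = f j x
    rw [hsj j hj, one_mul]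
  · funext x
    show s 0 * f 0 x = (-f 0) x
    rw [hs0, neg_one_mul, Pi.neg_apply]

/-- ★ **AL1 with a positive ground state.**  For every `k` there are `k+1` smooth, colour-invariant, `L²`-orthonormal,
exponentially decaying classical eigenfunctions `f_0, …, f_k` of `𝔥` at the invariant levels `physLevel 1, …, physLevel (k+1)`
(the clauses of the tree's PROVED fact `LuscherHamiltonianEigenfunctions k`) whose ground state is STRICTLY POSITIVE:
`f_0(x) > 0` for all `x ∈ ℝ⁹`. [cite: ReedSimonIV1978, Thm. XIII.47–48, Thm. XIII.64] [cite: LiebLoss2001, Thm. 11.8] -/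
theorem exists_eigenfunctions_pos_groundState (k : ℕ) :
    ∃ f : Fin (k + 1) → ZM → ℝ,
      (∀ j, ∀ n : ℕ∞, ContDiff ℝ n (f j)) ∧ (∀ j, IsGaugeInv (f j)) ∧
      (∀ i j, ∫ x, f i x * f j x = if i = j then (1 : ℝ) else 0) ∧
      (∀ j, ∀ x : ZM, hApply (f j) x = physLevel ((j : ℕ) + 1) * f j x) ∧
      (∀ j, ExpDecay₂ (f j)) ∧ (∀ x, 0 < f 0 x) := by
  obtain ⟨f, hsmooth, hinv, horth, heig, hdec⟩ := LuscherHamiltonianEigenfunctions_holds k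
  obtain ⟨f', h1, h2, h3, h4, h5, hpos, -, -⟩ := exists_pos_groundState_of_clauses hsmooth hinv horth heig hdec
  exact ⟨f', h1, h2, h3, h4, h5, hpos⟩

end Literature.Analysis.OperatorTheory.YMMatrixModel

end
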